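/-
Copyright: H21 programme, solo seat `solo-RiemannHypothesis-informed` (session 5).
-/
import Summits.RiemannHypothesis.RiemannHypothesis.Theorems.SoloInformedClusterThreshold
import Summits.RiemannHypothesis.RiemannHypothesis.Theorems.SoloInformedDecay

/-!
# Far off-line zeros cost no hypothesis beyond their offset (solo-informed, T28a–b)

In the local sampling bound (T11, `weilSamplingEnergy_le_local_eff`) every off-line zero of the
height window must be put into the exceptional set `S`, whose terms `m(ρ)|ĝ(ρ)|²` are kept.
T25 kills those terms by dodging.  Here the terms of exceptional zeros that are FAR from `γ₀` in
height (`|Im ρ − γ₀| ≥ Δ₀ ≥ 1`) and have offset `|Re ρ − ½| ≤ θ` are simply BOUNDED, using the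
order-`p` decay of the test (`norm_weilMellin_le_of_isWeilTest`) and the density lemma with the
definite constant (`finsum_weilZeroIndex_le_of_kernel_bound_eff`):

* `sum_offline_far_le` (**T28a**): `Σ_{ρ ∈ S_f} m(ρ)|ĝ(ρ)|² ≤
  2·A₁·(2 (e^{θa}‖k^{(p)}‖₁)² / Δ₀^{2p−2})·log(|γ₀| + 2)` for any finite set `S_f` of zeros with
  offsets `≤ θ < ½` at height distance `≥ Δ₀` from `γ₀` (`p ≥ 1`);
* `weilGroundEnergy_le_local_of_oddTest_cluster_far` / `…_neg_…` (**T28b**): T12/T13 with a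
  dodged exceptional set `S'` AND a bounded one `S_f`.

With `θ = |η|` (the designated zero has MAXIMAL offset in its window) the factor `e^{2θa}` is
exactly gain-sized, so far exceptions cost only `Δ₀^{−(2p−2)}` relative to the gain: this is what
lets T28 (`SoloInformedClusterFar`) replace "local RH in the polylog window" by "no larger offset in
the polylog window, and a bounded cluster in the near zone `|Im ρ − γ₀| < Δ₀`".
-/

open MeasureTheory Complex Set Filter Topology Literature.NumberTheory.LFunctions
open scoped ContDiff ComplexConjugate

namespace Summit.RiemannHypothesis.RiemannHypothesis.Theorems

/-! ## T28a: the far exceptional terms under an offset bound -/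

/-- **T28a (far off-line zeros).**  For a Weil test `k` on `[−a, a]`, `p ≥ 1`, `Δ₀ ≥ 1`,
`θ < ½` and a finite set `S_f` of zeros of `ζ` with `|Re ρ − ½| ≤ θ` and `|Im ρ − γ₀| ≥ Δ₀`:
`Σ_{ρ∈S_f} m(ρ) |ĝ(ρ)|² ≤ 2·zetaDensityConst·(2 (e^{θa} ‖k^{(p)}‖₁)²/Δ₀^{2p−2})·log(|γ₀|+2)`,
`ĝ(ρ) = ∫ k e^{(ρ−½−iγ₀)t}`. -/
theorem sum_offline_far_le {k : ℝ → ℂ} (hk : IsWeilTest k) {a : ℝ} (ha : 0 ≤ a)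
    (hks : tsupport k ⊆ Icc (-a) a) {θ γ₀ Δ₀ : ℝ} (hθ2 : θ < 1 / 2) (hΔ : 1 ≤ Δ₀) {p : ℕ}
    (hp : 1 ≤ p) (Sf : Finset ℂ)
    (hfar : ∀ ρ ∈ Sf, riemannZeta ρ = 0 ∧ |ρ.re - 1 / 2| ≤ θ ∧ Δ₀ ≤ |ρ.im - γ₀|) :
    ∑ ρ ∈ Sf, (riemannZetaZeroOrder ρ : ℝ) *
        ‖weilMellin (fun t ↦ k t * cexp (-(γ₀ * I) * t)) ρ‖ ^ 2 ≤
      2 * zetaDensityConst *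
          (2 * (Real.exp (θ * a) * ∫ t, ‖iteratedDeriv p k t‖) ^ 2 / Δ₀ ^ (2 * p - 2)) *
        Real.log (|γ₀| + 2) := by
  classical
  set Np : ℝ := ∫ t, ‖iteratedDeriv p k t‖ with hNp_def
  have hNp0 : 0 ≤ Np := integral_nonneg fun _ ↦ norm_nonneg _
  set M : ℝ := 2 * (Real.exp (θ * a) * Np) ^ 2 / Δ₀ ^ (2 * p - 2) with hM_def
  have hΔ0 : 0 < Δ₀ := by linarith
  have hM : 0 ≤ M := by rw [hM_def]; positivity
  set w : ℂ → ℝ := fun ρ ↦ ‖weilMellin (fun t ↦ k t * cexp (-(γ₀ * I) * t)) ρ‖ ^ 2 with hw_def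
  -- pointwise: the far terms sit under the Cauchy majorant `M/(1+(Im ρ − γ₀)²)`
  have hpt : ∀ ρ ∈ Sf, w ρ ≤ M / (1 + (ρ.im - γ₀) ^ 2) := by
    intro ρ hρ
    obtain ⟨-, hre, hΔρ⟩ := hfar ρ hρ
    simp only [hw_def]
    rw [weilMellin_mul_cexp]
    set s : ℂ := ρ + -(γ₀ * I) with hs
    set Δ : ℝ := |ρ.im - γ₀| with hΔdef
    have hΔ1 : 1 ≤ Δ := hΔ.trans hΔρ
    have hΔpos : 0 < Δ := by linarith
    have hsre : s.re - 1 / 2 = ρ.re - 1 / 2 := by simp [hs]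
    have hsim : (s - 1 / 2).im = ρ.im - γ₀ := by simp [hs]; ring
    have hnorm_ge : Δ ≤ ‖s - 1 / 2‖ := by
      rw [hΔdef, ← hsim]; exact Complex.abs_im_le_norm _
    have hdec := norm_weilMellin_le_of_isWeilTest hk hks p s
    have hexp : Real.exp (|s.re - 1 / 2| * a) ≤ Real.exp (θ * a) := by
      rw [hsre]; exact Real.exp_le_exp.mpr (mul_le_mul_of_nonneg_right hre ha)
    have hsp : Δ ^ p ≤ ‖s - 1 / 2‖ ^ p := pow_le_pow_left₀ hΔpos.le hnorm_ge p
    have hΔp : 0 < Δ ^ p := pow_pos hΔpos p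
    have hks_le : ‖weilMellin k s‖ ≤ Real.exp (θ * a) * Np / Δ ^ p := by
      rw [le_div_iff₀ hΔp]
      calc ‖weilMellin k s‖ * Δ ^ p ≤ ‖weilMellin k s‖ * ‖s - 1 / 2‖ ^ p :=
            mul_le_mul_of_nonneg_left hsp (norm_nonneg _)
        _ = ‖s - 1 / 2‖ ^ p * ‖weilMellin k s‖ := mul_comm _ _
        _ ≤ Real.exp (|s.re - 1 / 2| * a) * Np := hdec
        _ ≤ Real.exp (θ * a) * Np := mul_le_mul_of_nonneg_right hexp hNp0
    have hsq : ‖weilMellin k s‖ ^ 2 ≤ (Real.exp (θ * a) * Np) ^ 2 / (Δ ^ p) ^ 2 := by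
      rw [← div_pow]; exact pow_le_pow_left₀ (norm_nonneg _) hks_le 2
    have hΔsq : Δ ^ 2 = (ρ.im - γ₀) ^ 2 := by rw [hΔdef, sq_abs]
    have hpp : (Δ ^ p) ^ 2 = Δ ^ (2 * p - 2) * Δ ^ 2 := by
      rw [← pow_mul, ← pow_add]; congr 1; omega
    have hlow : Δ₀ ^ (2 * p - 2) * ((1 + (ρ.im - γ₀) ^ 2) / 2) ≤ (Δ ^ p) ^ 2 := by
      rw [hpp]
      refine mul_le_mul (pow_le_pow_left₀ hΔ0.le hΔρ _) ?_ (by positivity) (by positivity)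
      rw [← hΔsq]; nlinarith
    have hden : 0 < Δ₀ ^ (2 * p - 2) * ((1 + (ρ.im - γ₀) ^ 2) / 2) := by positivity
    calc ‖weilMellin k s‖ ^ 2 ≤ (Real.exp (θ * a) * Np) ^ 2 / (Δ ^ p) ^ 2 := hsq
      _ ≤ (Real.exp (θ * a) * Np) ^ 2 / (Δ₀ ^ (2 * p - 2) * ((1 + (ρ.im - γ₀) ^ 2) / 2)) :=
          div_le_div_of_nonneg_left (sq_nonneg _) hden hlow
      _ = M / (1 + (ρ.im - γ₀) ^ 2) := by
          have h1 : Δ₀ ^ (2 * p - 2) ≠ 0 := pow_ne_zero _ hΔ0.ne'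
          have h2 : (1 + (ρ.im - γ₀) ^ 2) ≠ 0 := by positivity
          rw [hM_def]
          field_simp
  -- the weight `F = w·𝟙_{S_f}` is under the majorant on the whole strip
  set F : ℂ → ℝ := fun ρ ↦ if ρ ∈ Sf then w ρ else 0 with hF_def
  have hF : ∀ ρ : ℂ, 0 ≤ ρ.re → ρ.re ≤ 1 → F ρ ≤ M / (1 + (ρ.im - γ₀) ^ 2) := by
    intro ρ _ _
    by_cases hρ : ρ ∈ Sf
    · simp only [hF_def, hρ, if_true]; exact hpt ρ hρ
    · simp only [hF_def, hρ, if_false]; exact div_nonneg hM (by positivity)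
  -- `S_f ⊆ weilZeroIndex T` for `T = Σ |Im ρ|`
  set T : ℝ := ∑ ρ ∈ Sf, |ρ.im| with hT_def
  have hsub : ∀ ρ ∈ Sf, ρ ∈ weilZeroIndex T := by
    intro ρ hρ
    obtain ⟨hz, hre, -⟩ := hfar ρ hρ
    have h0 : 0 < ρ.re := by have := (abs_le.mp hre).1; linarith
    have h1 : ρ.re < 1 := by have := (abs_le.mp hre).2; linarith
    refine ⟨hz, h0.le, h1.le, im_ne_zero_of_riemannZeta_eq_zero hz h0 h1, ?_⟩
    exact Finset.single_le_sum (f := fun ρ : ℂ ↦ |ρ.im|) (fun _ _ ↦ abs_nonneg _) hρ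
  have hfin := weilZeroIndex_finite T
  have hbound := finsum_weilZeroIndex_le_of_kernel_bound_eff F M γ₀ hM hF T
  rw [finsum_mem_eq_finite_toFinset_sum _ hfin] at hbound
  have hle : ∑ ρ ∈ Sf, (riemannZetaZeroOrder ρ : ℝ) * w ρ ≤
      ∑ ρ ∈ hfin.toFinset, (riemannZetaZeroOrder ρ : ℝ) * F ρ := by
    have e : ∑ ρ ∈ Sf, (riemannZetaZeroOrder ρ : ℝ) * w ρ =
        ∑ ρ ∈ Sf, (riemannZetaZeroOrder ρ : ℝ) * F ρ :=
      Finset.sum_congr rfl fun ρ hρ ↦ by simp only [hF_def, hρ, if_true]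
    rw [e]
    refine Finset.sum_le_sum_of_subset_of_nonneg
      (fun ρ hρ ↦ (Set.Finite.mem_toFinset _).mpr (hsub ρ hρ)) ?_
    intro ρ _ hρn
    simp only [hF_def, hρn, if_false, mul_zero, le_refl]
  exact hle.trans hbound

/-! ## T28b: T12/T13 with a dodged exceptional set and a bounded one -/

/-- **T28b (le form).**  As `weilGroundEnergy_le_local_of_oddTest_cluster` (T12 for clusters),
with a second exceptional set `S_f` of points `≠ 1` whose terms are bounded by `B_f` instead of
vanishing: `ε(a) ≤ (majorant·log(|γ₀|+2) + B_f − 2m(ρ₀)|∫ k e^{ηt}|²)/‖k‖₂²`. -/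
theorem weilGroundEnergy_le_local_of_oddTest_cluster_far :
    ∀ (k : ℝ → ℂ) (a η γ₀ R Bf : ℝ) (n : ℕ) (S' Sf : Finset ℂ), IsWeilTest k →
      (∀ t, k (-t) = -k t) → 0 ≤ a → 1 ≤ R → tsupport k ⊆ Icc (-a) a →
      0 < ∫ t, ‖k t‖ ^ 2 → riemannZeta (1 / 2 + η + γ₀ * I) = 0 → |η| < 1 / 2 →
      η ≠ 0 → γ₀ ≠ 0 →
      (∀ ρ ∈ S', weilMellin (fun t ↦ k t * cexp (-(γ₀ * I) * t)) ρ = 0) →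
      (∀ ρ ∈ Sf, ρ ≠ 1) →
      (∑ ρ ∈ Sf, (riemannZetaZeroOrder ρ : ℝ) *
          ‖weilMellin (fun t ↦ k t * cexp (-(γ₀ * I) * t)) ρ‖ ^ 2 ≤ Bf) →
      (∀ ρ : ℂ, riemannZeta ρ = 0 → 0 ≤ ρ.re → ρ.re ≤ 1 → |ρ.im - γ₀| < R → ρ.re ≠ 1 / 2 →
          ρ = 1 / 2 + η + γ₀ * I ∨ ρ = 1 / 2 - η + γ₀ * I ∨ ρ ∈ S' ∨ ρ ∈ Sf) →
        weilGroundEnergy a ≤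
          (2 * zetaDensityConst * (((∫ t : ℝ, ‖k t‖) ^ 2 + (∫ t : ℝ, ‖deriv k t‖) ^ 2)
                + 2 * Real.exp a * (∫ t : ℝ, ‖iteratedDeriv (n + 1) k t‖) ^ 2 / R ^ (2 * n))
              * Real.log (|γ₀| + 2) + Bf
            - 2 * ((riemannZetaZeroOrder (1 / 2 + η + γ₀ * I) : ℝ)
                * ‖∫ t : ℝ, k t * cexp ((η : ℂ) * t)‖ ^ 2))
            / ∫ t, ‖k t‖ ^ 2 := by
  intro k a η γ₀ R Bf n S' Sf hk hodd ha hR hks hpos hζ hη hη0 hγ hvan hSf1 hBf hloc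
  classical
  have hS := weilSamplingEnergy_le_local_eff
  set ρ₀ : ℂ := 1 / 2 + η + γ₀ * I with hρ₀
  set ρ₁ : ℂ := 1 / 2 - η + γ₀ * I with hρ₁
  set w : ℂ → ℝ := fun ρ ↦ ‖weilMellin (fun t ↦ k t * cexp (-(γ₀ * I) * t)) ρ‖ ^ 2 with hw_def
  set G : ℝ := ‖∫ t : ℝ, k t * cexp ((η : ℂ) * t)‖ ^ 2 with hG
  set S₁ : Finset ℂ := {ρ₀, ρ₁} ∪ S'.erase 1 with hS₁
  have hρ₀1 : ρ₀ ≠ 1 := by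
    intro h1; have := congrArg Complex.im h1; simp [hρ₀] at this; exact hγ this
  have hρ₁1 : ρ₁ ≠ 1 := by
    intro h1; have := congrArg Complex.im h1; simp [hρ₁] at this; exact hγ this
  have hS1 : ∀ ρ ∈ S₁ ∪ Sf, ρ ≠ 1 := by
    intro ρ hρ
    rcases Finset.mem_union.mp hρ with h | h
    · rcases Finset.mem_union.mp h with hp | hs
      · rcases Finset.mem_insert.mp hp with h0 | h1
        · rw [h0]; exact hρ₀1
        · rw [Finset.mem_singleton.mp h1]; exact hρ₁1
      · exact (Finset.mem_erase.mp hs).1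
    · exact hSf1 ρ h
  have hloc' : ∀ ρ : ℂ, riemannZeta ρ = 0 → 0 ≤ ρ.re → ρ.re ≤ 1 → |ρ.im - γ₀| < R →
      ρ ∉ S₁ ∪ Sf → ρ.re = 1 / 2 := by
    intro ρ hz h0 h1 hnear hρS
    by_contra hre
    have hρ1 : ρ ≠ 1 := by rintro rfl; exact riemannZeta_one_ne_zero hz
    rcases hloc ρ hz h0 h1 hnear hre with h | h | h | h
    · exact hρS (Finset.mem_union_left _ (Finset.mem_union_left _ (by rw [h]; simp)))
    · exact hρS (Finset.mem_union_left _ (Finset.mem_union_left _ (by rw [h]; simp)))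
    · exact hρS (Finset.mem_union_left _
        (Finset.mem_union_right _ (Finset.mem_erase.mpr ⟨hρ1, h⟩)))
    · exact hρS (Finset.mem_union_right _ h)
  have hB := hS k a γ₀ R n (S₁ ∪ Sf) hk ha hR hks hS1 hloc'
  -- the sum over `S₁` is `2 m(ρ₀) G` (T12 bookkeeping)
  -- the value of the `S₁`-sum: `2 m(ρ₀) G` (T12 bookkeeping)
  have e1 : ∀ (f : ℝ → ℂ) (c : ℝ), ∫ t : ℝ, f t * cexp ((c : ℂ) * t) =
      weilMellin f (1 / 2 + c) := by
    intro f c; unfold weilMellin; congr 1 with t; congr 2; ring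
  have hval : ∀ c : ℝ, w (1 / 2 + c + γ₀ * I) = ‖∫ t : ℝ, k t * cexp ((c : ℂ) * t)‖ ^ 2 := by
    intro c
    simp only [hw_def]
    rw [weilMellin_mul_cexp]
    have e0 : (1 / 2 + (c : ℂ) + γ₀ * I + -(γ₀ * I)) = 1 / 2 + c := by ring
    rw [e0, e1]
  have hne : ρ₀ ≠ ρ₁ := by
    intro h01; have := congrArg Complex.re h01; simp [hρ₀, hρ₁] at this; exact hη0 (by linarith)
  have hval0 : w ρ₀ = G := by rw [hρ₀, hval η]
  have hval1 : w ρ₁ = G := by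
    have e : ρ₁ = 1 / 2 + ((-η : ℝ) : ℂ) + γ₀ * I := by rw [hρ₁]; push_cast; ring
    rw [e, hval (-η), hG]
    have hint : ∫ t : ℝ, k t * cexp (((-η : ℝ) : ℂ) * t) =
        -∫ t : ℝ, k t * cexp ((η : ℂ) * t) := by
      rw [← integral_odd_mul_cexp_neg hodd η]
      congr 1 with t; push_cast; ring_nf
    rw [hint, norm_neg]
  have hm1 : (riemannZetaZeroOrder ρ₁ : ℝ) = riemannZetaZeroOrder ρ₀ := by
    have e : ρ₁ = conj (1 - ρ₀) := by
      apply Complex.ext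
      · simp [hρ₀, hρ₁]; ring
      · simp [hρ₀, hρ₁]
    have h0 : 0 < ρ₀.re := by have := (abs_lt.mp hη).1; simp [hρ₀]; linarith
    have h1 : ρ₀.re < 1 := by have := (abs_lt.mp hη).2; simp [hρ₀]; linarith
    rw [e, riemannZetaZeroOrder_conj_holds (1 - ρ₀), riemannZetaZeroOrder_one_sub_holds h0 h1]
  have hsumP : ∑ ρ ∈ ({ρ₀, ρ₁} : Finset ℂ), (riemannZetaZeroOrder ρ : ℝ) * w ρ =
      2 * ((riemannZetaZeroOrder ρ₀ : ℝ) * G) := by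
    rw [Finset.sum_pair hne, hval0, hval1, hm1]; ring
  have hsum1 : ∑ ρ ∈ S₁, (riemannZetaZeroOrder ρ : ℝ) * w ρ =
      2 * ((riemannZetaZeroOrder ρ₀ : ℝ) * G) := by
    rw [← hsumP, hS₁]
    symm
    refine Finset.sum_subset Finset.subset_union_left fun ρ hρS hρP ↦ ?_
    rcases Finset.mem_union.mp hρS with hp | hs
    · exact absurd hp hρP
    · simp only [hw_def]
      rw [hvan ρ (Finset.mem_of_mem_erase hs), norm_zero]
      ring
  -- nonnegativity of the terms on `S₁ ∪ S_f` and the union bound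
  have hnn : ∀ ρ ∈ S₁ ∪ Sf, 0 ≤ (riemannZetaZeroOrder ρ : ℝ) * w ρ := by
    intro ρ hρ
    have hm : (0 : ℝ) ≤ riemannZetaZeroOrder ρ := by
      exact_mod_cast riemannZetaZeroOrder_nonneg (hS1 ρ hρ)
    exact mul_nonneg hm (sq_nonneg _)
  have hunion : ∑ ρ ∈ S₁ ∪ Sf, (riemannZetaZeroOrder ρ : ℝ) * w ρ ≤
      2 * ((riemannZetaZeroOrder ρ₀ : ℝ) * G) + Bf := by
    have h := Finset.sum_union_inter (s₁ := S₁) (s₂ := Sf)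
      (f := fun ρ ↦ (riemannZetaZeroOrder ρ : ℝ) * w ρ)
    have hint : 0 ≤ ∑ ρ ∈ S₁ ∩ Sf, (riemannZetaZeroOrder ρ : ℝ) * w ρ :=
      Finset.sum_nonneg fun ρ hρ ↦ hnn ρ
        (Finset.mem_union_left _ (Finset.mem_inter.mp hρ).1)
    have hBf' : ∑ ρ ∈ Sf, (riemannZetaZeroOrder ρ : ℝ) * w ρ ≤ Bf := hBf
    linarith [hsum1]
  have hB' : ∀ T : ℝ, ∑ᶠ ρ ∈ weilZeroIndex T, (riemannZetaZeroOrder ρ : ℝ) *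
      ‖weilMellin (fun t ↦ k t * cexp (-(γ₀ * I) * t)) ρ‖ ^ 2 ≤
      2 * zetaDensityConst * (((∫ t : ℝ, ‖k t‖) ^ 2 + (∫ t : ℝ, ‖deriv k t‖) ^ 2)
          + 2 * Real.exp a * (∫ t : ℝ, ‖iteratedDeriv (n + 1) k t‖) ^ 2 / R ^ (2 * n))
        * Real.log (|γ₀| + 2) + (2 * ((riemannZetaZeroOrder ρ₀ : ℝ) * G) + Bf) :=
    fun T ↦ (hB T).trans (by simp only [hw_def] at hunion; linarith [hunion])
  have key := weilGroundEnergy_le_of_oddDipole hk hodd hks hpos hζ hη.le hγ hB'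
  refine key.trans_eq ?_
  congr 1
  rw [hG]
  ring

/-- **T28b (threshold form).**  If `majorant·log(|γ₀|+2) + B_f < 2m(ρ₀)|∫ k e^{ηt}|²` then
`ε(a) < 0`. -/
theorem weilGroundEnergy_neg_of_local_oddTest_cluster_far :
    ∀ (k : ℝ → ℂ) (a η γ₀ R Bf : ℝ) (n : ℕ) (S' Sf : Finset ℂ), IsWeilTest k →
      (∀ t, k (-t) = -k t) → 0 ≤ a → 1 ≤ R → tsupport k ⊆ Icc (-a) a →
      0 < ∫ t, ‖k t‖ ^ 2 → riemannZeta (1 / 2 + η + γ₀ * I) = 0 → |η| < 1 / 2 →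
      η ≠ 0 → γ₀ ≠ 0 →
      (∀ ρ ∈ S', weilMellin (fun t ↦ k t * cexp (-(γ₀ * I) * t)) ρ = 0) →
      (∀ ρ ∈ Sf, ρ ≠ 1) →
      (∑ ρ ∈ Sf, (riemannZetaZeroOrder ρ : ℝ) *
          ‖weilMellin (fun t ↦ k t * cexp (-(γ₀ * I) * t)) ρ‖ ^ 2 ≤ Bf) →
      (∀ ρ : ℂ, riemannZeta ρ = 0 → 0 ≤ ρ.re → ρ.re ≤ 1 → |ρ.im - γ₀| < R → ρ.re ≠ 1 / 2 →
          ρ = 1 / 2 + η + γ₀ * I ∨ ρ = 1 / 2 - η + γ₀ * I ∨ ρ ∈ S' ∨ ρ ∈ Sf) →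
      2 * zetaDensityConst * (((∫ t : ℝ, ‖k t‖) ^ 2 + (∫ t : ℝ, ‖deriv k t‖) ^ 2)
            + 2 * Real.exp a * (∫ t : ℝ, ‖iteratedDeriv (n + 1) k t‖) ^ 2 / R ^ (2 * n))
          * Real.log (|γ₀| + 2) + Bf
        < 2 * ((riemannZetaZeroOrder (1 / 2 + η + γ₀ * I) : ℝ)
            * ‖∫ t : ℝ, k t * cexp ((η : ℂ) * t)‖ ^ 2) →
        weilGroundEnergy a < 0 := by
  intro k a η γ₀ R Bf n S' Sf hk hodd ha hR hks hpos hζ hη hη0 hγ hvan hSf1 hBf hloc hwin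
  have key := weilGroundEnergy_le_local_of_oddTest_cluster_far k a η γ₀ R Bf n S' Sf hk hodd ha
    hR hks hpos hζ hη hη0 hγ hvan hSf1 hBf hloc
  exact key.trans_lt (div_neg_of_neg_of_pos (by linarith) hpos)

end Summit.RiemannHypothesis.RiemannHypothesis.Theorems
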